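import Summits.ABC.StewartYu.ArchG3RecLinesD
import Summits.ABC.StewartYu.ArchG3RecLinesClosedK
import HarnessLib

/-!
# The archimedean record `ArchG3Rec` — the κ-GENERIC directional atoms of the closed letter lines `LinesClosedK κ c`
# (cell abc-stewartyu, crux r2 `ArchCoreRat` stmt-ABC-20502, line `arch-g3-frame`, seam (B) of `stub_recLinesArch`; seat p4 g10)

Support file (theorems only; no named facts, no definitions).  p5's `ArchG3RecLinesClosedK` replaced the shaped-basis adjugate
letter `(n−1)!` of `sRR/LbR/btR/ΓR/yR/CR/YR` by a PARAMETER `κ` (`sRRK κ/LbRK κ/btRK κ/ΓRK κ/yRK κ/CRK κ/YRK κ`; the line closes at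
`κ := 2^{n−1}`, p5's ✓ `SatData.abs_C_le_two_pow`, plan R49′).  This file is the κ-generic form of p1 g11's ✓ atom bounds of
`ArchG3RecLinesC`/`ArchG3RecLinesD` — the SAME statements and proofs with `n!` ↦ `κ·n` (`κ ≥ 1`; `κ·(n−1) + 1 ≤ κ·n` replaces
`(n−1)!·(n−1) + 1 ≤ n!`):

* `sRRK_le`: `sRRK κ k ≤ (3/2)·(κn)·N·L + 2`; `LbRK_le`: `LbRK κ lev k ≤ 2·sRRK κ k/2^lev ≤ 2·sRRK κ k ≤ 4(κn)·N·L`;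
  `btRK_le`: `0 ≤ btRK κ k ≤ (κn)·N·Bexp·Alast`; `YRK_le`: `0 ≤ YRK κ lev ≤ 10·n·(κn)·Bexp·N²·L` (no sorting needed);
* WITH SORTED WEIGHTS (`Monotone P.A` — the shaped frame's letter; WITHOUT it the jets radius carries `Ω·L` and the (J) lines are
  false for `log Ω ≫ cⁿ`, see `ArchG3RecLinesD`): `AθR_sRRK_le`: `AθR k·sRRK κ k ≤ 3·n·(κn)·N·L`; `AθR_btRK_le`:
  `AθR k·btRK κ k ≤ (3/2)·n·(κn)·N·Bexp·Alast`; `yRK_le`: `0 ≤ yRK κ lev ≤ 6n²(κn)NL/2^lev + 8n²(κn)·Bexp·N²·L`;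
  `log_CRK_le`: `1 ≤ CRK κ lev`, `log(2·CRK κ lev) ≤ log 2 + log(1 + (7/2)·n²·(κn)·Bexp·N²·2^lev)` (NO `log L`, NO `log Ω`).

Proofs adapted verbatim from `ArchG3RecLinesC`/`ArchG3RecLinesD` (p1 g11).  WHAT THIS IS NOT: no letter line; no crux moves.

## References
* [Nesterenko2003] Yu. V. Nesterenko, LNM 1819 (2003) — §3.4–3.5 (3.25), (3.36); §4.2 Lemma 4.3, (4.22); §4.3 (4.48).
-/

noncomputable section

open Finset Real
open scoped Nat

namespace Summit.ABC.StewartYu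

namespace ArchG3Rec

open PadicG3Par (Cb Cb_pos)
open ArchG3Par (G K yloadK G_eq G_pos K_pos yloadK_pos)

variable {n : ℕ} (P : ArchG3Rec n)

/-- `κ·(n−1) + 1 ≤ κ·n` and `1 ≤ κ`, `1 ≤ κ·n` (real) for `1 ≤ κ`, `1 ≤ n` (the κ-form of `(n−1)!(n−1) + 1 ≤ n!`). [folklore] -/
theorem kappa_pred_le {κ n : ℕ} (hκ : 1 ≤ κ) (hn : 1 ≤ n) : (κ : ℝ) * (n - 1) + 1 ≤ κ * n ∧ (1 : ℝ) ≤ κ ∧ (1 : ℝ) ≤ (κ : ℝ) * n := by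
  have hκ1 : (1 : ℝ) ≤ κ := by exact_mod_cast hκ
  have hn1 : (1 : ℝ) ≤ n := by exact_mod_cast hn
  refine ⟨by nlinarith, hκ1, by nlinarith⟩

/-- **`sRR k ≤ (3/2)·n!·N·L + 2`** (each `2Bv j + 1 ≤ (3/2)NL`, `#{j > k} ≤ n − 1`, `(n−1)!(n−1) + 1 ≤ n!`). [folklore] -/
theorem sRRK_le (κ : ℕ) (hκ : 1 ≤ κ) (k : Fin n) : (P.sRRK κ k : ℝ) ≤ 3 / 2 * (κ * n) * (P.N * P.L) + 2 ∧ (0 : ℝ) ≤ P.sRRK κ k := by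
  obtain ⟨hf, hf1, hκn1⟩ := kappa_pred_le hκ P.hn
  have hb := fun j => (P.box_le j).2.2.1
  have hNL : 0 ≤ P.N * (P.L : ℝ) := by have := P.N_facts.1; positivity
  have hcard_nat : (Ioi k).card ≤ n - 1 := by
    have : (Ioi k).card < n := by
      have : (Ioi k).card < (univ : Finset (Fin n)).card :=
        card_lt_card (ssubset_of_subset_of_ne (subset_univ _) fun h' => by
          have : k ∈ Ioi k := by rw [h']; exact mem_univ _
          simp at this)
      simpa using this
    omega
  have hcard : ((Ioi k).card : ℝ) ≤ n - 1 := by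
    have : ((Ioi k).card : ℝ) ≤ ((n - 1 : ℕ) : ℝ) := by exact_mod_cast hcard_nat
    rw [Nat.cast_sub P.hn] at this; simpa using this
  have hsum : ∑ j ∈ Ioi k, (2 * (P.Bv j : ℝ) + 1) ≤ (n - 1) * (3 / 2 * (P.N * P.L)) := by
    calc ∑ j ∈ Ioi k, (2 * (P.Bv j : ℝ) + 1) ≤ ∑ _j ∈ Ioi k, (3 / 2 * ((P.N : ℝ) * P.L)) := sum_le_sum fun j _ => hb j
      _ = (Ioi k).card * (3 / 2 * (P.N * P.L)) := by rw [sum_const, nsmul_eq_mul]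
      _ ≤ (n - 1) * (3 / 2 * (P.N * P.L)) := mul_le_mul_of_nonneg_right hcard (by positivity)
  refine ⟨?_, Nat.cast_nonneg _⟩
  unfold sRRK; push_cast
  have hk := hb k
  have hf0 : (0 : ℝ) ≤ κ := Nat.cast_nonneg _
  calc (κ : ℝ) * ∑ j ∈ Ioi k, (2 * (P.Bv j : ℝ) + 1) + (2 * (P.Bv k : ℝ) + 1) + 2
      ≤ κ * ((n - 1) * (3 / 2 * (P.N * P.L))) + 3 / 2 * (P.N * P.L) + 2 := by
        gcongr
    _ = ((κ : ℝ) * (n - 1) + 1) * (3 / 2 * (P.N * P.L)) + 2 := by ring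
    _ ≤ (κ * n) * (3 / 2 * (P.N * P.L)) + 2 := by gcongr
    _ = 3 / 2 * (κ * n) * (P.N * P.L) + 2 := by ring


/-- **`LbR lev k ≤ 2·sRR k/2^lev ≤ 2·sRR k`**, hence `LbR lev k ≤ 4·n!·N·L` (`N·L ≥ 4`). [folklore] -/
theorem LbRK_le (κ : ℕ) (hκ : 1 ≤ κ) (lev : ℕ) (k : Fin n) : (P.LbRK κ lev k : ℝ) ≤ 2 * (P.sRRK κ k : ℝ) / 2 ^ lev ∧ (P.LbRK κ lev k : ℝ) ≤ 2 * P.sRRK κ k ∧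
    (P.LbRK κ lev k : ℝ) ≤ 4 * (κ * n) * (P.N * P.L) ∧ (0 : ℝ) ≤ P.LbRK κ lev k := by
  obtain ⟨hs, hs0⟩ := P.sRRK_le κ hκ k
  have h1 : (P.LbRK κ lev k : ℝ) ≤ 2 * (P.sRRK κ k : ℝ) / 2 ^ lev := by
    unfold LbRK
    have := Nat.cast_div_le (m := 2 * P.sRRK κ k) (n := 2 ^ lev) (α := ℝ)
    push_cast at this; exact this
  have h2 : 2 * (P.sRRK κ k : ℝ) / 2 ^ lev ≤ 2 * P.sRRK κ k :=
    div_le_self (by positivity) (one_le_pow₀ (by norm_num))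
  have hNL : (4 : ℝ) ≤ P.N * P.L := by
    have hN := P.N_facts.2.1
    have hL := P.L_real.2.2.1
    have h4 : (4 : ℝ) ≤ 2 ^ (n + 25) := le_trans (by norm_num) (pow_le_pow_right₀ (by norm_num) (by omega : 2 ≤ n + 25))
    nlinarith
  have hf1 : (1 : ℝ) ≤ (κ : ℝ) * n := (kappa_pred_le hκ P.hn).2.2
  refine ⟨h1, h1.trans h2, (h1.trans h2).trans ?_, Nat.cast_nonneg _⟩
  nlinarith


/-- **`0 ≤ btR k ≤ n!·N·Bexp·Alast`** (`1/A j ≤ 1`, `#{j > k} ≤ n − 1`). [folklore] -/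
theorem btRK_le (κ : ℕ) (hκ : 1 ≤ κ) (k : Fin n) : 0 ≤ P.btRK κ k ∧ P.btRK κ k ≤ (κ * n) * P.N * P.Bexp * P.Alast := by
  obtain ⟨hf, hf1, hκn1⟩ := kappa_pred_le hκ P.hn
  obtain ⟨hAl1, -, -, -, -, hB1⟩ := P.Alast_facts
  have hN := P.N_facts.1
  have hA := P.A_facts
  have hs0 : 0 ≤ ∑ j ∈ Ioi k, 1 / P.A j := sum_nonneg fun j _ => by have := (hA j).1; positivity
  have hs : ∑ j ∈ Ioi k, 1 / P.A j ≤ n - 1 := by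
    have hcard : (Ioi k).card ≤ n - 1 := by
      have : (Ioi k).card < n := by
        have : (Ioi k).card < (univ : Finset (Fin n)).card :=
          card_lt_card (ssubset_of_subset_of_ne (subset_univ _) fun h' => by
            have : k ∈ Ioi k := by rw [h']; exact mem_univ _
            simp at this)
        simpa using this
      omega
    calc ∑ j ∈ Ioi k, 1 / P.A j ≤ ∑ _j ∈ Ioi k, (1 : ℝ) :=
          sum_le_sum fun j _ => (div_le_one (hA j).1).mpr (hA j).2.1
      _ = (Ioi k).card := by simp
      _ ≤ ((n - 1 : ℕ) : ℝ) := by exact_mod_cast hcard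
      _ = n - 1 := by rw [Nat.cast_sub P.hn]; simp
  have hk : 1 / P.A k ≤ 1 := (div_le_one (hA k).1).mpr (hA k).2.1
  have hc : 0 ≤ P.N * P.Bexp * P.Alast := by positivity
  have hf0 : (0 : ℝ) ≤ κ := Nat.cast_nonneg _
  refine ⟨?_, ?_⟩
  · unfold btRK
    have hk0 : 0 ≤ P.N * P.Bexp * P.Alast / P.A k := div_nonneg hc (hA k).1.le
    have : 0 ≤ (κ : ℝ) * P.N * P.Bexp * P.Alast * ∑ j ∈ Ioi k, 1 / P.A j := by
      have e : (κ : ℝ) * P.N * P.Bexp * P.Alast * ∑ j ∈ Ioi k, 1 / P.A j =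
          (κ : ℝ) * (P.N * P.Bexp * P.Alast) * ∑ j ∈ Ioi k, 1 / P.A j := by ring
      rw [e]; exact mul_nonneg (mul_nonneg hf0 hc) hs0
    linarith
  unfold btRK
  calc (κ : ℝ) * P.N * P.Bexp * P.Alast * ∑ j ∈ Ioi k, 1 / P.A j + P.N * P.Bexp * P.Alast / P.A k
      = (P.N * P.Bexp * P.Alast) * ((κ : ℝ) * ∑ j ∈ Ioi k, 1 / P.A j + 1 / P.A k) := by ring
    _ ≤ (P.N * P.Bexp * P.Alast) * ((κ : ℝ) * (n - 1) + 1) := by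
        apply mul_le_mul_of_nonneg_left _ hc; gcongr
    _ ≤ (P.N * P.Bexp * P.Alast) * (κ * n) := mul_le_mul_of_nonneg_left hf hc
    _ = (κ * n) * P.N * P.Bexp * P.Alast := by ring


/-- **the weight ceiling `0 ≤ YR lev ≤ 10·n·n!·Bexp·N²·L`** (`B·N·LbR ≤ 4n!BN²L`, `2btR(2Bv jl+3) ≤ 6n!BN²L`). [cite: Nesterenko2003, (3.36); shape only] -/
theorem YRK_le (κ : ℕ) (hκ : 1 ≤ κ) (lev : ℕ) : 0 ≤ P.YRK κ lev ∧ P.YRK κ lev ≤ 10 * n * (κ * n) * P.Bexp * P.N ^ 2 * P.L := by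
  obtain ⟨hAl1, -, hAl2, hjl, -, hB1⟩ := P.Alast_facts
  have hN := P.N_facts
  have hL := P.L_real
  have hterm : ∀ k, 0 ≤ P.Bexp * P.N * (P.LbRK κ lev k : ℝ) + 2 * P.btRK κ k * (2 * P.Bv P.jl + 3 : ℝ) ∧
      P.Bexp * P.N * (P.LbRK κ lev k : ℝ) + 2 * P.btRK κ k * (2 * P.Bv P.jl + 3 : ℝ) ≤ 10 * (κ * n) * P.Bexp * P.N ^ 2 * P.L := by
    intro k
    obtain ⟨-, -, hLb, hLb0⟩ := P.LbRK_le κ hκ lev k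
    obtain ⟨hbt0, hbt⟩ := P.btRK_le κ hκ k
    refine ⟨by positivity, ?_⟩
    have h1 : P.Bexp * P.N * (P.LbRK κ lev k : ℝ) ≤ P.Bexp * P.N * (4 * (κ * n) * (P.N * P.L)) :=
      mul_le_mul_of_nonneg_left hLb (by positivity)
    -- `btR·(2Bv jl + 3) ≤ n! N B Alast ((3/2)NL/Alast + 3) = n! N B ((3/2) NL + 3 Alast) ≤ 3 n! B N² L`
    have h2 : P.btRK κ k * (2 * P.Bv P.jl + 3 : ℝ) ≤ (κ * n) * P.N * P.Bexp * (3 / 2 * (P.N * P.L) + 3 * P.Alast) := by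
      calc P.btRK κ k * (2 * P.Bv P.jl + 3 : ℝ) ≤ ((κ * n) * P.N * P.Bexp * P.Alast) * (3 / 2 * (P.N * P.L) / P.Alast + 3) :=
            mul_le_mul hbt hjl (by positivity) (by positivity)
        _ = (κ * n) * P.N * P.Bexp * (3 / 2 * (P.N * P.L) + 3 * P.Alast) := by field_simp
    have h3 : 3 / 2 * (P.N * P.L) + 3 * P.Alast ≤ 3 * (P.N * P.L) := by linarith
    have hf0 : (0 : ℝ) ≤ (κ * n) * P.N * P.Bexp := by positivity
    nlinarith [mul_le_mul_of_nonneg_left h3 hf0]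
  refine ⟨sum_nonneg fun k _ => (hterm k).1, ?_⟩
  unfold YRK
  calc ∑ k, (P.Bexp * P.N * (P.LbRK κ lev k : ℝ) + 2 * P.btRK κ k * (2 * P.Bv P.jl + 3 : ℝ))
      ≤ ∑ _k : Fin n, 10 * (κ * n) * P.Bexp * P.N ^ 2 * P.L := sum_le_sum fun k _ => (hterm k).2
    _ = 10 * n * (κ * n) * P.Bexp * P.N ^ 2 * P.L := by simp; ring


/-- **sorted weights: `AθR k·sRR k ≤ 3·n·n!·N·L`** (the pairing `(Σ_{j≤k}A j)(Σ_{j>k}(2Bv j+1)) ≤ (3/2)NL·n(n−1)` kills the weights). [folklore] -/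
theorem AθR_sRRK_le (κ : ℕ) (hκ : 1 ≤ κ) (hmono : Monotone P.A) (k : Fin n) : P.AθR k * P.sRRK κ k ≤ 3 * n * (κ * n) * (P.N * P.L) := by
  obtain ⟨h1, h0, h2⟩ := P.AθR_le hmono k
  obtain ⟨hf, hf1, hκn1⟩ := kappa_pred_le hκ P.hn
  have hA := P.A_facts
  have hN := P.N_facts.1
  have hNL : 0 ≤ P.N * (P.L : ℝ) := by positivity
  have hb := fun j => (P.box_le j).1
  have hAk := (P.box_le k).2.1
  -- `AθR·Σ_{j>k}(2Bv j+1) ≤ (3/2)NL·AθR·Σ 1/A j ≤ (3/2) NL n (n−1)`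
  have hS : P.AθR k * ∑ j ∈ Ioi k, (2 * (P.Bv j : ℝ) + 1) ≤ 3 / 2 * (P.N * P.L) * (n * (n - 1)) := by
    calc P.AθR k * ∑ j ∈ Ioi k, (2 * (P.Bv j : ℝ) + 1) ≤ P.AθR k * ∑ j ∈ Ioi k, 3 / 2 * (P.N * P.L) / P.A j :=
          mul_le_mul_of_nonneg_left (sum_le_sum fun j _ => hb j) h0
      _ = 3 / 2 * (P.N * P.L) * (P.AθR k * ∑ j ∈ Ioi k, 1 / P.A j) := by
          rw [mul_sum, mul_sum, mul_sum]; refine sum_congr rfl fun j _ => ?_; ring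
      _ ≤ 3 / 2 * (P.N * P.L) * (n * (n - 1)) := mul_le_mul_of_nonneg_left h2 (by positivity)
  -- `AθR·(2Bv k+1) ≤ n A k·(3/2)NL/A k = (3/2) n NL`
  have hAk0 : P.A k ≠ 0 := (hA k).1.ne'
  have hK : P.AθR k * (2 * (P.Bv k : ℝ) + 1) ≤ 3 / 2 * n * (P.N * P.L) := by
    calc P.AθR k * (2 * (P.Bv k : ℝ) + 1) ≤ (n * P.A k) * (3 / 2 * (P.N * P.L) / P.A k) :=
          mul_le_mul h1 (hb k) (by positivity) (by have := (hA k).1; positivity)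
      _ = 3 / 2 * n * (P.N * P.L) := by field_simp
  -- `AθR·2 ≤ 2 n A k ≤ n NL`
  have hn0 : (0 : ℝ) ≤ n := Nat.cast_nonneg n
  have h2' : P.AθR k * 2 ≤ n * (P.N * P.L) := by nlinarith
  unfold sRRK; push_cast
  have hf0 : (0 : ℝ) ≤ κ := Nat.cast_nonneg _
  have e : P.AθR k * ((κ : ℝ) * ∑ j ∈ Ioi k, (2 * (P.Bv j : ℝ) + 1) + (2 * (P.Bv k : ℝ) + 1) + 2) =
      (κ : ℝ) * (P.AθR k * ∑ j ∈ Ioi k, (2 * (P.Bv j : ℝ) + 1)) + P.AθR k * (2 * (P.Bv k : ℝ) + 1) + P.AθR k * 2 := by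
    ring
  rw [e]
  have h3 : (κ : ℝ) * (P.AθR k * ∑ j ∈ Ioi k, (2 * (P.Bv j : ℝ) + 1)) ≤
      (κ : ℝ) * (3 / 2 * (P.N * P.L) * (n * (n - 1))) := mul_le_mul_of_nonneg_left hS hf0
  -- `(n-1)!·n(n−1) ≤ n·n! − n` (from `(n−1)!(n−1) + 1 ≤ n!`)
  have h4 : (κ : ℝ) * (n * (n - 1)) ≤ (n : ℝ) * ((κ : ℝ) * n) - n := by nlinarith [mul_le_mul_of_nonneg_left hf hn0]
  have h5 : (κ : ℝ) * (3 / 2 * (P.N * P.L) * (n * (n - 1))) ≤ 3 / 2 * (P.N * P.L) * ((n : ℝ) * ((κ : ℝ) * n) - n) := by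
    have := mul_le_mul_of_nonneg_left h4 (show (0:ℝ) ≤ 3 / 2 * (P.N * P.L) by positivity)
    linarith [this]
  have hf1' : (1 : ℝ) ≤ (κ : ℝ) * n := (kappa_pred_le hκ P.hn).2.2
  have h6 : (n : ℝ) * (P.N * P.L) ≤ n * (κ * n) * (P.N * P.L) := by
    have := mul_le_mul_of_nonneg_left hf1' (show (0:ℝ) ≤ n * (P.N * P.L) by positivity)
    linarith [this]
  linarith


/-- **sorted weights: `AθR k·btR k ≤ (3/2)·n·n!·N·Bexp·Alast`**. [folklore] -/
theorem AθR_btRK_le (κ : ℕ) (hκ : 1 ≤ κ) (hmono : Monotone P.A) (k : Fin n) : P.AθR k * P.btRK κ k ≤ 3 / 2 * n * (κ * n) * P.N * P.Bexp * P.Alast := by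
  obtain ⟨h1, h0, h2⟩ := P.AθR_le hmono k
  obtain ⟨hf, hf1, hκn1⟩ := kappa_pred_le hκ P.hn
  obtain ⟨hAl1, -, -, -, -, hB1⟩ := P.Alast_facts
  have hA := P.A_facts k
  have hN := P.N_facts.1
  have hc : 0 ≤ P.N * P.Bexp * P.Alast := by positivity
  have hf0 : (0 : ℝ) ≤ κ := Nat.cast_nonneg _
  unfold btRK
  have e : P.AθR k * ((κ : ℝ) * P.N * P.Bexp * P.Alast * ∑ j ∈ Ioi k, 1 / P.A j + P.N * P.Bexp * P.Alast / P.A k) =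
      (P.N * P.Bexp * P.Alast) * ((κ : ℝ) * (P.AθR k * ∑ j ∈ Ioi k, 1 / P.A j) + P.AθR k / P.A k) := by ring
  rw [e]
  have h3 : P.AθR k / P.A k ≤ n := by rw [div_le_iff₀ hA.1]; exact h1
  have h4 : (κ : ℝ) * (P.AθR k * ∑ j ∈ Ioi k, 1 / P.A j) + P.AθR k / P.A k ≤
      (κ : ℝ) * (n * (n - 1)) + n := by gcongr
  have hn1 : (1 : ℝ) ≤ n := by exact_mod_cast P.hn
  have hfn : (1 : ℝ) ≤ (κ : ℝ) * n := (kappa_pred_le hκ P.hn).2.2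
  -- `(n−1)!·n(n−1) + n ≤ n·n! + n ≤ (3/2) n n!`… using `(n-1)!(n-1)+1 ≤ n!`: `(n-1)! n (n-1) + n = n((n-1)!(n-1) + 1) ≤ n·n!`
  have h5 : (κ : ℝ) * (n * (n - 1)) + n ≤ n * (κ * n) := by nlinarith
  have hx : 0 ≤ (n : ℝ) * (κ * n) * (P.N * P.Bexp * P.Alast) := mul_nonneg (by positivity) hc
  calc (P.N * P.Bexp * P.Alast) * ((κ : ℝ) * (P.AθR k * ∑ j ∈ Ioi k, 1 / P.A j) + P.AθR k / P.A k)
      ≤ (P.N * P.Bexp * P.Alast) * (n * (κ * n)) := mul_le_mul_of_nonneg_left (h4.trans h5) hc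
    _ = n * (κ * n) * (P.N * P.Bexp * P.Alast) := by ring
    _ ≤ 3 / 2 * n * (κ * n) * P.N * P.Bexp * P.Alast := by linarith [hx]


/-- **sorted weights: the jets scalar `0 ≤ yR lev ≤ 14·n²·n!·Bexp·N²·L`** and, with `LbR lev ≤ 2sRR/2^lev`, the level form
`yR lev ≤ 6·n²·n!·N·L/2^lev + 8·n²·n!·Bexp·N²·L`… stated as the pair used by `CR`. [cite: Nesterenko2003, §4.2 Lemma 4.3; shape only] -/
theorem yRK_le (κ : ℕ) (hκ : 1 ≤ κ) (hmono : Monotone P.A) (lev : ℕ) : 0 ≤ P.yRK κ lev ∧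
    P.yRK κ lev ≤ 6 * n ^ 2 * (κ * n) * (P.N * P.L) / 2 ^ lev + 8 * n ^ 2 * (κ * n) * P.Bexp * P.N ^ 2 * P.L := by
  obtain ⟨hAl1, -, hAl2, -, hjl, hB1⟩ := P.Alast_facts
  have hN := P.N_facts
  have hL := P.L_real
  have hterm : ∀ k, 0 ≤ P.AθR k * P.ΓRK κ lev k ∧
      P.AθR k * P.ΓRK κ lev k ≤ 6 * n * (κ * n) * (P.N * P.L) / 2 ^ lev + 8 * n * (κ * n) * P.Bexp * P.N ^ 2 * P.L := by
    intro k
    obtain ⟨-, h0, -⟩ := P.AθR_le hmono k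
    obtain ⟨hLb1, -, -, hLb0⟩ := P.LbRK_le κ hκ lev k
    obtain ⟨hbt0, -⟩ := P.btRK_le κ hκ k
    have hS := P.AθR_sRRK_le κ hκ hmono k
    have hB := P.AθR_btRK_le κ hκ hmono k
    have hΓ0 : 0 ≤ P.ΓRK κ lev k := by unfold ΓRK; positivity
    refine ⟨mul_nonneg h0 hΓ0, ?_⟩
    unfold ΓRK
    -- `AθR·LbR ≤ 2·AθR·sRR/2^lev ≤ 6 n n! NL/2^lev`
    have h1 : P.AθR k * (P.LbRK κ lev k : ℝ) ≤ 6 * n * (κ * n) * (P.N * P.L) / 2 ^ lev := by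
      calc P.AθR k * (P.LbRK κ lev k : ℝ) ≤ P.AθR k * (2 * (P.sRRK κ k : ℝ) / 2 ^ lev) := mul_le_mul_of_nonneg_left hLb1 h0
        _ = 2 * (P.AθR k * P.sRRK κ k) / 2 ^ lev := by ring
        _ ≤ 2 * (3 * n * (κ * n) * (P.N * P.L)) / 2 ^ lev := by gcongr
        _ = 6 * n * (κ * n) * (P.N * P.L) / 2 ^ lev := by ring
    -- `AθR·2btR·((2Bv jl+1)/N + 2) ≤ 2·(3/2) n n! N B Alast·((3/2)L/Alast + 2) = 3 n n! N B((3/2)L + 2Alast) ≤ 8 n n! B N² L`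
    have h2 : P.AθR k * (2 * P.btRK κ k * ((2 * P.Bv P.jl + 1 : ℝ) / P.N + 2)) ≤ 8 * n * (κ * n) * P.Bexp * P.N ^ 2 * P.L := by
      have e : P.AθR k * (2 * P.btRK κ k * ((2 * P.Bv P.jl + 1 : ℝ) / P.N + 2)) =
          2 * (P.AθR k * P.btRK κ k) * ((2 * P.Bv P.jl + 1 : ℝ) / P.N + 2) := by ring
      rw [e]
      have hBA : 0 ≤ P.Bexp := by linarith
      have hAl0 : 0 < P.Alast := by linarith
      have hAlne : P.Alast ≠ 0 := hAl0.ne'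
      have hcoef : 0 ≤ 3 * (n : ℝ) * (κ * n) * P.N * P.Bexp := by positivity
      have hj0 : 0 ≤ (2 * P.Bv P.jl + 1 : ℝ) / P.N + 2 := by positivity
      calc 2 * (P.AθR k * P.btRK κ k) * ((2 * P.Bv P.jl + 1 : ℝ) / P.N + 2)
          ≤ 2 * (3 / 2 * n * (κ * n) * P.N * P.Bexp * P.Alast) * (3 / 2 * P.L / P.Alast + 2) :=
            mul_le_mul (by linarith) hjl hj0 (by positivity)
        _ = 3 * n * (κ * n) * P.N * P.Bexp * (3 / 2 * P.L + 2 * P.Alast) := by field_simp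
        _ ≤ 3 * n * (κ * n) * P.N * P.Bexp * (3 / 2 * P.L + P.N * P.L) :=
            mul_le_mul_of_nonneg_left (by linarith) hcoef
        _ ≤ 8 * n * (κ * n) * P.Bexp * P.N ^ 2 * P.L := by
            have hL1 : (P.L : ℝ) ≤ P.N * (P.L : ℝ) := by nlinarith
            have := mul_le_mul_of_nonneg_left hL1 hcoef
            nlinarith [this]
    linarith
  refine ⟨by unfold yRK; exact sum_nonneg fun k _ => (hterm k).1, ?_⟩
  unfold yRK
  calc ∑ k, P.AθR k * P.ΓRK κ lev k ≤ ∑ _k : Fin n, (6 * n * (κ * n) * (P.N * P.L) / 2 ^ lev + 8 * n * (κ * n) * P.Bexp * P.N ^ 2 * P.L) :=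
        sum_le_sum fun k _ => (hterm k).2
    _ = 6 * n ^ 2 * (κ * n) * (P.N * P.L) / 2 ^ lev + 8 * n ^ 2 * (κ * n) * P.Bexp * P.N ^ 2 * P.L := by simp; ring


/-- **sorted weights: the Cauchy radius** `1 ≤ CR lev` and `log(2·CR lev) ≤ log 2 + log(1 + (7/2)·n²·n!·Bexp·N²·2^lev)`
(`yR/T` with `T ≥ 8L/2^{lev+1}`: the `L` cancels — no `log L`). [folklore] -/
theorem log_CRK_le (κ : ℕ) (hκ : 1 ≤ κ) (hmono : Monotone P.A) (lev : ℕ) : 1 ≤ P.CRK κ lev ∧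
    Real.log (2 * P.CRK κ lev) ≤ Real.log 2 + Real.log (1 + 7 / 2 * n ^ 2 * (κ * n) * P.Bexp * P.N ^ 2 * 2 ^ lev) := by
  obtain ⟨hy0, hy⟩ := P.yRK_le κ hκ hmono lev
  obtain ⟨hT, hT1⟩ := P.T_ge_half lev
  have hB1 := P.Alast_facts.2.2.2.2.2
  have hN := P.N_facts
  have hL := P.L_real
  have h1 : 1 ≤ P.CRK κ lev := le_max_left _ _
  refine ⟨h1, ?_⟩
  -- `yR/T ≤ yR·2^{lev+1}/(8L) ≤ (3/2) n² n! N + 2 n² n! B N² 2^lev ≤ (7/2) n² n! B N² 2^lev`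
  have hq : P.yRK κ lev / P.T lev ≤ 7 / 2 * n ^ 2 * (κ * n) * P.Bexp * P.N ^ 2 * 2 ^ lev := by
    rw [div_le_iff₀ (by linarith)]
    have h2l : (0 : ℝ) < 2 ^ lev := by positivity
    have e1 : 6 * (n : ℝ) ^ 2 * (κ * n) * (P.N * P.L) / 2 ^ lev = (6 * n ^ 2 * (κ * n) * P.N) * ((P.L : ℝ) / 2 ^ lev) := by ring
    have hTL : (P.L : ℝ) / 2 ^ lev ≤ P.T lev / 4 := by
      rw [pow_succ] at hT
      rw [div_le_iff₀ h2l]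
      have := (div_le_iff₀ (by positivity : (0:ℝ) < 2 ^ lev * 2)).mp hT
      linarith
    have hTL2 : (P.L : ℝ) ≤ P.T lev / 4 * 2 ^ lev := by rwa [div_le_iff₀ h2l] at hTL
    have hc1 : 0 ≤ 6 * n ^ 2 * (κ * n) * (P.N : ℝ) := by positivity
    have hc2 : 0 ≤ 8 * n ^ 2 * (κ * n) * P.Bexp * (P.N : ℝ) ^ 2 := by positivity
    have hN1 : (P.N : ℝ) ≤ P.N ^ 2 := by nlinarith
    calc P.yRK κ lev ≤ (6 * n ^ 2 * (κ * n) * P.N) * ((P.L : ℝ) / 2 ^ lev) + (8 * n ^ 2 * (κ * n) * P.Bexp * P.N ^ 2) * (P.L : ℝ) := by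
            rw [← e1]; linarith
      _ ≤ (6 * n ^ 2 * (κ * n) * P.N) * (P.T lev / 4) + (8 * n ^ 2 * (κ * n) * P.Bexp * P.N ^ 2) * (P.T lev / 4 * 2 ^ lev) := by
          have hBA : 0 ≤ P.Bexp := by linarith
          gcongr
      _ ≤ 7 / 2 * n ^ 2 * (κ * n) * P.Bexp * P.N ^ 2 * 2 ^ lev * P.T lev := by
          have h2l1 : (1 : ℝ) ≤ 2 ^ lev := one_le_pow₀ (by norm_num)
          have hT0 : (0 : ℝ) ≤ P.T lev := by linarith
          have : (6 * n ^ 2 * (κ * n) * (P.N : ℝ)) ≤ 6 * n ^ 2 * (κ * n) * P.Bexp * P.N ^ 2 * 2 ^ lev := by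
            have hc3 : (0 : ℝ) ≤ 6 * n ^ 2 * ((κ : ℝ) * n) := by positivity
            calc (6 * n ^ 2 * (κ * n) * (P.N : ℝ)) = 6 * n ^ 2 * (κ * n) * 1 * P.N * 1 := by ring
              _ ≤ 6 * n ^ 2 * (κ * n) * P.Bexp * P.N ^ 2 * 2 ^ lev := by gcongr
          nlinarith
  have hCR : P.CRK κ lev ≤ 1 + 7 / 2 * n ^ 2 * (κ * n) * P.Bexp * P.N ^ 2 * 2 ^ lev := by
    unfold CRK
    exact max_le (by have : (0:ℝ) ≤ 7 / 2 * n ^ 2 * (κ * n) * P.Bexp * P.N ^ 2 * 2 ^ lev := by positivity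
                     linarith) (by linarith)
  have hpos : 0 < P.CRK κ lev := by linarith
  rw [Real.log_mul (by norm_num) hpos.ne']
  gcongr


end ArchG3Rec

end Summit.ABC.StewartYu

end
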